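import Literature.NumberTheory.EllipticCurves.SkinnerUrban2014.RankZeroPPartOfMainConjectureProofs
import Literature.NumberTheory.EllipticCurves.SkinnerUrban2014.PAdicUnitPeriodRatioProofs
import Literature.NumberTheory.EllipticCurves.Greenberg1999.RankZeroEulerCharacteristicOddPrimeProofs
import HarnessLib

/-!
# Skinner–Urban 2014, Thm. 3.6.11 (a) from Thm. 3.6.9 with every auxiliary input a NAMED,
# theorem-grade fact: modularity, Greenberg's Thm. 4.1, Mazur's Cor. 4.1 (proofs only)

C. Skinner, E. Urban, *The Iwasawa main conjectures for `GL₂`*, Invent. Math. 195 (2014), Thm. 3.6.11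
(a) (author version p. 46 = Thm. 2 (a), p. 3) and its printed proof ("This follows from the equality
`(𝓛_f) = (L_E) = F_E`, the interpolation properties of `𝓛_f` and `L_E`, and Theorem 4.1 of [Gr99]",
p. 46 l. 25).  HONEST FRAMING (cell `b2b-bsdres`, home `run/shared/lean/b2b/bsd-rank1-residual/`): the
cell deletes COMBINATION-shaped residual classes of analytic-rank `≤ 1` curves from PUBLISHED
theorems only and types the construction-shaped ones; this is not "finishing BSD".  A *proofs* file
(theorems only: no definition, no named fact; D-0026).

The tree derives bsd.S30 (`padicValRat_bsd_rank_zero`, Thm. 3.6.11 (a)) from bsd.S21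
(`skinner_urban_main_conjecture`, Thm. 3.6.9) in `RankZeroPPartOfMainConjectureProofs`
(`padicValRat_bsd_rank_zero_of_mainConjecture_of_ram`, this unit, gen 5) under four binders:
modularity with an integral Manin constant (`nonempty_modularParametrizationData`), Thm. 3.6.9
(`hSU`), Greenberg's rank-`0` Euler-characteristic formula in the shape `hGr`, and the INLINE period
unit `hϖ` (`ord_p(Ω⁺_f/Ω_E) = 0`).  The sibling file `PAdicUnitPeriodRatioProofs` (gen 7) proves
`hϖ` from Mazur 1978, Cor. 4.1 (`mazur_not_dvd_maninConstant_of_odd`, lattice form;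
`periodUnit_of_mazur`), and `hGr` IS the body of the named fact `greenberg_charValue_rankZero`
(`IwasawaLeadingTerm.lean`, Greenberg LNM 1716 Thm. 4.1).  Hence:

* `padicValRat_bsd_rank_zero_of_mainConjecture_of_mazur` — **bsd.S30 from bsd.S21 + modularity +
  `greenberg_charValue_rankZero` + `mazur_not_dvd_maninConstant_of_odd`**, four NAMED facts of the
  tree, each with a printed proof, and nothing inline;
* `mainConjecture_rankZero_inputs_of_mazur` — the same packaged as one implication for the cell's
  registry (S–U route, row C1 at `r = 0`: the inputs of Thm. 2 (a) over the tree are exactly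
  {Thm. 3.6.9, BCDT modularity, Greenberg Thm. 4.1, Mazur Cor. 4.1}).

## References

* [SkinnerUrban2014] Thm. 3.6.9 (p. 45), Thm. 3.6.11 (a) and its proof (p. 46), §3.6.7 (p. 45,
  the period unit).
* [GreenbergLNM1716] R. Greenberg, LNM 1716 (1999), Thm. 4.1 (p. 102).
* [Mazur1978] B. Mazur, Invent. Math. 44 (1978), Cor. 4.1.
* [GreenbergVatsal2000] Invent. Math. 142 (2000), §3, Remark 3.4.
* [BCDTJAMS2001] Breuil–Conrad–Diamond–Taylor, J. Amer. Math. Soc. 14 (2001), Thm. A.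
-/

set_option autoImplicit false

noncomputable section

open scoped Classical MatrixGroups ModularForm

open CongruenceSubgroup WeierstrassCurve Literature.NumberTheory.EllipticCurves.ModularForms

namespace Literature.NumberTheory.EllipticCurves.SkinnerUrban2014

/-- **Skinner–Urban Thm. 3.6.11 (a) (bsd.S30) from Thm. 3.6.9 (bsd.S21), modularity, Greenberg's
Thm. 4.1 and Mazur's Cor. 4.1 — four named facts, nothing inline.** The period-unit binder `hϖ` of
`padicValRat_bsd_rank_zero_of_mainConjecture_of_ram` is `periodUnit_of_mazur hM`
(`PAdicUnitPeriodRatioProofs`: Ω_E = u·Ω⁺_f with |u|_p = 1 at an odd good prime with `E[p]`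
irreducible, from the Manin constant of the optimal curve), and its `hGr` is the named fact
`greenberg_charValue_rankZero` verbatim. [cite: SkinnerUrban2014, Thm. 3.6.11 (a) and its proof (p. 46)]
[cite: GreenbergLNM1716, Thm. 4.1 (p. 102)] [cite: Mazur1978, Cor. 4.1]
[cite: GreenbergVatsal2000, §3, Remark 3.4] -/
theorem padicValRat_bsd_rank_zero_of_mainConjecture_of_mazur
    (hmod : nonempty_modularParametrizationData)
    (hSU : ∀ (W : WeierstrassCurve ℚ) [W.IsElliptic] [W.IsGloballyMinimal] (p : ℕ) [Fact p.Prime]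
      (κ : ZpExtension ℚ p) (γ : Field.absoluteGaloisGroup ℚ) (N : ℕ) [NeZero N]
      (f : CuspForm (Gamma0 N) 2),
      skinner_urban_main_conjecture W p (κ := κ) (γ := γ) (f := f))
    (hGr : greenberg_charValue_rankZero) (hM : mazur_not_dvd_maninConstant_of_odd) :
    padicValRat_bsd_rank_zero :=
  padicValRat_bsd_rank_zero_of_mainConjecture_of_ram hmod hSU hGr (periodUnit_of_mazur hM)

/-- **The inputs of Thm. 2 (a) over the tree, as one implication**: Thm. 3.6.9 for every
`(E, p, κ, γ, f)` ∧ modularity ∧ Greenberg Thm. 4.1 ∧ Mazur Cor. 4.1 ⟹ Thm. 3.6.11 (a).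
[cite: SkinnerUrban2014, Thm. 3.6.11 (a) (p. 46) and Thm. 3.6.9 (p. 45)]
[cite: GreenbergLNM1716, Thm. 4.1 (p. 102)] [cite: Mazur1978, Cor. 4.1] -/
theorem mainConjecture_rankZero_inputs_of_mazur :
    ((∀ (W : WeierstrassCurve ℚ) [W.IsElliptic] [W.IsGloballyMinimal] (p : ℕ) [Fact p.Prime]
        (κ : ZpExtension ℚ p) (γ : Field.absoluteGaloisGroup ℚ) (N : ℕ) [NeZero N]
        (f : CuspForm (Gamma0 N) 2), skinner_urban_main_conjecture W p (κ := κ) (γ := γ) (f := f)) ∧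
      nonempty_modularParametrizationData ∧ greenberg_charValue_rankZero ∧
      mazur_not_dvd_maninConstant_of_odd) → padicValRat_bsd_rank_zero :=
  fun ⟨hSU, hmod, hGr, hM⟩ ↦ padicValRat_bsd_rank_zero_of_mainConjecture_of_mazur hmod hSU hGr hM

/-! ### Appended 2026-08-21 (lit-su gen 8): the two-rank currency — Greenberg's Thm. 4.1 replaced by
BMS Thm. 1.7 (odd `p`) + the Mazur–Tate `σ`-function (odd `p`) -/

/-- **Skinner–Urban Thm. 3.6.11 (a) (bsd.S30) from Thm. 3.6.9 (bsd.S21), modularity, Mazur's Cor. 4.1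
and — in place of Greenberg's Thm. 4.1 — the Perrin-Riou–Schneider leading-term theorem at odd `p`
(BMS 2016 Thm. 1.7, whose case `r = 0` IS Greenberg's theorem) with the Mazur–Tate `σ`-function at odd
`p` (canonical-height binder).** Five named facts, nothing inline; this is the currency of the cell's
TWO-RANK theorems, which hold `hS`, `hMT` for their rank-`1` half anyway, so that on such rows the
Greenberg binder disappears (`greenberg_charValue_rankZero_of_Schneider1985_odd`).
[cite: SkinnerUrban2014, Thm. 3.6.11 (a) and its proof (p. 46)]
[cite: BalakrishnanMullerStein2015, Thm. 1.7 and p. 3] [cite: MazurSteinTate2006, Thm. 1.3]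
[cite: Mazur1978, Cor. 4.1] -/
theorem padicValRat_bsd_rank_zero_of_mainConjecture_of_schneider_odd
    (hmod : nonempty_modularParametrizationData)
    (hSU : ∀ (W : WeierstrassCurve ℚ) [W.IsElliptic] [W.IsGloballyMinimal] (p : ℕ) [Fact p.Prime]
      (κ : ZpExtension ℚ p) (γ : Field.absoluteGaloisGroup ℚ) (N : ℕ) [NeZero N]
      (f : CuspForm (Gamma0 N) 2),
      skinner_urban_main_conjecture W p (κ := κ) (γ := γ) (f := f))
    (hS : Schneider1985_order_charGenerator_odd) (hMT : mazur_tate_sigma_exists_odd)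
    (hM : mazur_not_dvd_maninConstant_of_odd) :
    padicValRat_bsd_rank_zero :=
  padicValRat_bsd_rank_zero_of_mainConjecture_of_mazur hmod hSU
    (greenberg_charValue_rankZero_of_Schneider1985_odd hS hMT) hM

end Literature.NumberTheory.EllipticCurves.SkinnerUrban2014

end
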